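import Mathlib.Topology.Algebra.ClopenNhdofOne
import Mathlib.Data.Finite.Perm
import Literature.AnabelianGeometry.Anabelioids.QuotientAnabelioidProofs
import Literature.AnabelianGeometry.Anabelioids.GaloisFullSubcategory
import Literature.AnabelianGeometry.SemiGraphs.Commensurability
import Literature.AnabelianGeometry.SemiGraphs.BaseChange

/-!
# [SemiAnbd] Example 2.8 (trivial edge anabelioids), first half — proof

Mochizuki, *Semi-graphs of anabelioids*, Publ. RIMS **42** (2006), Example 2.8 p. 31
[cite: MochizukiSemiAnbd2006, Ex. 2.8 p.31]: "every semi-graph of anabelioids `𝒢` such that `𝒢_e`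
is trivial for all edges `e` is quasi-coherent.  In this case, a vertex `v` of `𝒢` is elevated if
and only if `Π_v` is infinite."  Discharges the named fact
`SemiGraphOfAnabelioids.example_2_8_quasiCoherent_elevated` (`Commensurability.lean`):
`example_2_8_quasiCoherent_elevated_holds`.

The construction (`exists_quotientApproximator`): given basepoints `F_v` and OPEN NORMAL
subgroups `N_v ⊆ Π_v = Aut F_v` of index dividing a common `M ≥ 1`, the *quotient approximator*
`𝒢 → 𝒢^N` replaces each `𝒢_v` by the quotient anabelioid `B(Π_v/N_v) ⊆ 𝒢_v`
(`QuotientAnabelioid.lean`), keeps the (trivial) `𝒢_e`, and restricts the `b_*`; it is the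
identity on `𝔾`, `π₁`-epimorphic (`isPi1Epi_fixedι`), of bounded order `M`
(`finite_aut_fixed_and_card`), has `Ker(Π_v → π₁(𝒢^N_v)) = N_v` (`ker_pi1Map_fixedι`), and ALL the
branch subgroups of `𝒢^N` are trivial (`pi1Map_eq_one_of_trivial_pi1`: for an exact `P : V ⥤ E`
into a connected anabelioid with trivial `π₁` and ANY functor `Fe` with `P ⋙ Fe ≅ F` a basepoint,
`Aut Fe` acts trivially on every `Fe(P A)`).

* quasi-coherence: `N_v :=` the normal core of the given covering `U_v` (index `∣ M!`,
  `index_normalCore_dvd_factorial`);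
* elevated `⇒` `Π_v` infinite: a `π₁`-epimorphic approximator maps `Π_v` ONTO the finite group
  `π₁(𝒢'_v) ⊇ N`, `|N| ≥ M`, for every `M` (`infinite_of_isElevated`);
* `Π_v` infinite `⇒` elevated: an infinite profinite group has open normal subgroups of index
  `≥ M` (`exists_openNormal_le_index`); take the quotient approximator for that `N_v` (and
  `N_w = Π_w` elsewhere) and `N := π₁(𝒢^N_v)` itself (`isElevated_of_infinite`).
-/

namespace Literature.AnabelianGeometry.Anabelioids

open CategoryTheory CategoryTheory.Limits CategoryTheory.PreGaloisCategory

universe w v₁ v₂ u₁ u₂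

/-! ### Group-theoretic preliminaries -/

section Groups

/-- The normal core of a subgroup of finite index `n` has index dividing `n!` (it is the kernel
of the action on the `n` cosets). [folklore] -/
private theorem index_normalCore_dvd_factorial {G : Type*} [Group G] (H : Subgroup G) [H.FiniteIndex] :
    H.normalCore.index ∣ Nat.factorial H.index := by
  classical
  haveI : Finite (G ⧸ H) := Subgroup.finite_quotient_of_finiteIndex
  rw [Subgroup.normalCore_eq_ker, Subgroup.index_ker, Subgroup.index, ← Nat.card_perm]
  exact Subgroup.card_subgroup_dvd_card _

/-- An infinite profinite group has open normal subgroups of arbitrarily large (finite) index.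
[folklore] -/
private theorem exists_openNormal_le_index {G : Type*} [Group G] [TopologicalSpace G]
    [IsTopologicalGroup G] [CompactSpace G] [TotallyDisconnectedSpace G] [T2Space G] [Infinite G]
    (M : ℕ) : ∃ N : Subgroup G, IsOpen (N : Set G) ∧ N.Normal ∧ M ≤ N.index := by
  classical
  obtain ⟨T, hT⟩ := Infinite.exists_subset_card_eq G M
  -- an open normal subgroup avoiding the finitely many `a⁻¹ b`, `a ≠ b ∈ T`
  let S : Finset G := ((T ×ˢ T).filter fun p => p.1 ≠ p.2).image fun p => p.1⁻¹ * p.2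
  have hSo : IsOpen ((↑S : Set G)ᶜ) := S.finite_toSet.isClosed.isOpen_compl
  have h1 : (1 : G) ∈ ((↑S : Set G)ᶜ) := by
    simp only [Set.mem_compl_iff, Finset.mem_coe, S, Finset.mem_image, Finset.mem_filter,
      Finset.mem_product, not_exists, not_and, and_imp, Prod.forall]
    intro a b _ _ hab h
    exact hab (inv_mul_eq_one.mp h)
  obtain ⟨N, hN⟩ := ProfiniteGrp.exist_openNormalSubgroup_sub_open_nhds_of_one hSo h1
  refine ⟨N.toSubgroup, N.isOpen', N.isNormal', ?_⟩
  haveI : Finite (G ⧸ N.toSubgroup) := N.toSubgroup.quotient_finite_of_isOpen N.isOpen'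
  letI : Fintype (G ⧸ N.toSubgroup) := Fintype.ofFinite _
  have hinj : Set.InjOn (fun t : G => (t : G ⧸ N.toSubgroup)) ↑T := by
    intro a ha b hb hab
    by_contra hne
    have hmem : a⁻¹ * b ∈ (N : Set G) := QuotientGroup.eq.mp hab
    have hS : a⁻¹ * b ∈ S := Finset.mem_image.mpr
      ⟨(a, b), Finset.mem_filter.mpr ⟨Finset.mem_product.mpr ⟨ha, hb⟩, hne⟩, rfl⟩
    exact hN hmem hS
  rw [← hT, Subgroup.index, Nat.card_eq_fintype_card, ← Finset.card_image_of_injOn hinj]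
  exact Finset.card_le_univ _

end Groups

/-! ### Branch subgroups into a connected anabelioid with trivial `π₁` are trivial -/

section TrivialPi1

variable {E : Type u₂} [Category.{v₂} E] [GaloisCategory E]

/-- In a connected anabelioid with trivial fundamental group, two objects with fibres of the same
cardinality are isomorphic (every bijection of fibres is `π₁`-equivariant, and `E → π₁-FinSets` is
fully faithful). [cite: SGA1, Exp. V §4] -/
theorem nonempty_iso_of_card_fiber_eq (FE : E ⥤ FintypeCat.{w}) [FiberFunctor FE]
    [Subsingleton (Aut FE)] {B₁ B₂ : E} (h : Nat.card (FE.obj B₁) = Nat.card (FE.obj B₂)) :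
    Nonempty (B₁ ≅ B₂) := by
  classical
  obtain ⟨e⟩ := Finite.card_eq.mp h
  let i : (functorToAction FE).obj B₁ ≅ (functorToAction FE).obj B₂ :=
    Action.mkIso (FintypeCat.equivEquivIso e) fun g => by
      rw [Subsingleton.elim g 1, map_one, map_one]
      rfl
  exact ⟨(functorToAction FE).preimageIso i⟩

/-- The fibre of a terminal object is a point. [folklore] -/
private theorem card_fiber_terminal' {V : Type u₁} [Category.{v₁} V] [GaloisCategory V]
    (F : V ⥤ FintypeCat.{w}) [FiberFunctor F] : Nat.card (F.obj (⊤_ V)) = 1 := by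
  obtain ⟨hU⟩ : Nonempty (Unique (F.obj (⊤_ V))) :=
    ⟨Types.isTerminalEquivUnique ((F ⋙ FintypeCat.incl).obj (⊤_ V))
      (IsTerminal.isTerminalObj (F ⋙ FintypeCat.incl) (⊤_ V) terminalIsTerminal)⟩
  exact Nat.card_unique

variable {V : Type u₁} [Category.{v₁} V] [GaloisCategory V]

/-- **Automorphisms of a "basepoint up to an exact functor into a trivial anabelioid" are
invisible**: for an exact `P : V ⥤ E` between connected anabelioids with `π₁(E) = 1`, a basepoint
`F` of `V`, and ANY functor `Fe : E ⥤ FinSets` with `P ⋙ Fe ≅ F`, every automorphism of `Fe`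
restricts to the identity along `P` — so the branch subgroups `Π_b ⊆ Π_v` of [SemiAnbd] Def. 2.1
vanish when `𝒢_e` is trivial, for every choice of `(Fe, α)`.  (Each `P A` is isomorphic in `E` to
`P` of a disjoint union of terminal objects, on which triviality is checked summand by summand.)
[cite: MochizukiSemiAnbd2006, Ex. 2.8 p.31] -/
theorem pi1Map_eq_one_of_trivial_pi1 (P : V ⥤ E) [PreservesFiniteLimits P]
    [PreservesFiniteColimits P]
    (htriv : ∀ (F : E ⥤ FintypeCat.{v₂}) [FiberFunctor F], Subsingleton (Aut F))
    (F : V ⥤ FintypeCat.{v₁}) [FiberFunctor F] (Fe : E ⥤ FintypeCat.{v₁}) (α : P ⋙ Fe ≅ F)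
    (τ : Aut Fe) : pi1Map P Fe τ = 1 := by
  classical
  -- a basepoint of `E`, and the induced basepoint `P ⋙ FE ≅ F`-up-to-universe of `V`
  let FE : E ⥤ FintypeCat.{v₂} := GaloisCategory.getFiberFunctor E
  haveI : Subsingleton (Aut FE) := htriv FE
  haveI : FiberFunctor (P ⋙ FE) := fiberFunctor_comp_of_exact _ _
  -- fibre cardinalities along `P`: `|FE (P A)| = |F A|`
  have hcardP : ∀ A : V, Nat.card (FE.obj (P.obj A)) = Nat.card (F.obj A) := by
    intro A
    let G := FintypeCat.uSwitch.{v₂, v₁}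
    haveI : FiberFunctor ((P ⋙ FE) ⋙ G) := FiberFunctor.comp_right _
    obtain ⟨e⟩ := nonempty_iso_of_fiberFunctor ((P ⋙ FE) ⋙ G) F
    rw [← Nat.card_congr (FintypeCat.equivEquivIso.symm (e.app A))]
    exact (Nat.card_congr ((FE.obj (P.obj A)).uSwitchEquiv)).symm
  -- the point transport `Fe (P X) ≃ F X`
  let ε : ∀ X : V, Fe.obj (P.obj X) ≃ F.obj X := fun X => FintypeCat.equivEquivIso.symm (α.app X)
  have hε : ∀ (X : V) (z : Fe.obj (P.obj X)), ε X z = α.hom.app X z := fun _ _ => rfl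
  have hεnat : ∀ {X Y : V} (f : X ⟶ Y) (y : F.obj X),
      (ε Y).symm (F.map f y) = Fe.map (P.map f) ((ε X).symm y) := by
    intro X Y f y
    apply (ε Y).injective
    rw [Equiv.apply_symm_apply, hε]
    have := NatTrans.naturality_apply α.hom f ((ε X).symm y)
    change α.hom.app Y (Fe.map (P.map f) ((ε X).symm y)) = F.map f (α.hom.app X ((ε X).symm y))
      at this
    rw [this, ← hε, Equiv.apply_symm_apply]
  -- (1) objects of every fibre size on whose `P`-image `τ` is trivial
  have hD : ∀ k : ℕ, ∃ D : V, Nat.card (F.obj D) = k ∧ τ.hom.app (P.obj D) = 𝟙 _ := by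
    intro k
    induction k with
    | zero =>
      refine ⟨⊥_ V, ?_, ?_⟩
      · haveI : IsEmpty (F.obj (⊥_ V)) := (initial_iff_fiber_empty F (⊥_ V)).mp ⟨initialIsInitial⟩
        simp
      · haveI : IsEmpty (F.obj (⊥_ V)) := (initial_iff_fiber_empty F (⊥_ V)).mp ⟨initialIsInitial⟩
        haveI : IsEmpty (Fe.obj (P.obj (⊥_ V))) := (ε _).isEmpty
        ext x
        exact isEmptyElim x
    | succ k ih =>
      obtain ⟨D, hDk, hτ⟩ := ih
      refine ⟨D ⨿ ⊤_ V, by rw [card_fiber_coprod_eq_sum, hDk, card_fiber_terminal'], ?_⟩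
      obtain ⟨-, -, hcompl⟩ := fiber_binaryCofan F (coprod.inl : D ⟶ D ⨿ ⊤_ V) coprod.inr
        (coprodIsCoprod D (⊤_ V))
      have hT : Subsingleton (Fe.obj (P.obj (⊤_ V))) := by
        haveI : Subsingleton (F.obj (⊤_ V)) :=
          (Nat.card_eq_one_iff_unique.mp (card_fiber_terminal' F)).1
        exact (ε _).subsingleton
      ext z
      rw [FintypeCat.id_apply]
      have hz : ε _ z ∈ Set.range (F.map (coprod.inl : D ⟶ D ⨿ ⊤_ V)) ⊔
          Set.range (F.map (coprod.inr : ⊤_ V ⟶ D ⨿ ⊤_ V)) := by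
        rw [hcompl.sup_eq_top]
        trivial
      rcases hz with ⟨y, hy⟩ | ⟨y, hy⟩
      · have hz' : z = Fe.map (P.map coprod.inl) ((ε D).symm y) := by
          rw [← hεnat, hy, Equiv.symm_apply_apply]
        rw [hz', NatTrans.naturality_apply τ.hom (P.map coprod.inl), hτ, FintypeCat.id_apply]
      · have hz' : z = Fe.map (P.map coprod.inr) ((ε (⊤_ V)).symm y) := by
          rw [← hεnat, hy, Equiv.symm_apply_apply]
        rw [hz', NatTrans.naturality_apply τ.hom (P.map coprod.inr)]
        congr 1
        exact Subsingleton.elim _ _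
  -- (2) transport to `P A` along an isomorphism `P D ≅ P A` of `E`
  refine Iso.ext ?_
  ext A x
  obtain ⟨D, hDk, hτ⟩ := hD (Nat.card (F.obj A))
  have hcard : Nat.card (FE.obj (P.obj D)) = Nat.card (FE.obj (P.obj A)) := by
    rw [hcardP, hcardP, hDk]
  obtain ⟨θ⟩ := nonempty_iso_of_card_fiber_eq FE hcard
  have hx : x = Fe.map θ.hom (Fe.map θ.inv x) := by
    rw [← FintypeCat.comp_apply, ← Fe.map_comp, θ.inv_hom_id, Fe.map_id, FintypeCat.id_apply]
  rw [pi1Map_hom_app]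
  change τ.hom.app (P.obj A) x = x
  rw [hx, NatTrans.naturality_apply τ.hom θ.hom, hτ, FintypeCat.id_apply]

end TrivialPi1

/-- The identity of a connected anabelioid is a `π₁`-epimorphism. [cite: MochizukiGeoAn2004, Def. 1.1.7(ii) p.14] -/
theorem isPi1Epi_id (X : Type u₁) [Category.{v₁} X] [GaloisCategory X] : IsPi1Epi (𝟭 X) :=
  fun _ _ τ => ⟨⟨τ.hom, τ.inv, τ.hom_inv_id, τ.inv_hom_id⟩, rfl⟩

end Literature.AnabelianGeometry.Anabelioids

namespace Literature.AnabelianGeometry.SemiGraphs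

open CategoryTheory CategoryTheory.Limits CategoryTheory.PreGaloisCategory
open Literature.AnabelianGeometry.Anabelioids
open scoped Pointwise

universe v₁ u₁ u

namespace SemiGraphOfAnabelioids

variable (𝒢 : SemiGraphOfAnabelioids.{v₁, u₁, u})

/-- **The quotient approximator** ([SemiAnbd] Ex. 2.8 / Def. 2.3): for `𝒢` with trivial edge
anabelioids, basepoints `F_v` and open normal subgroups `N_v ⊆ Π_v` whose indices divide a common
`M ≥ 1`, there is a `π₁`-epimorphic approximator `φ : 𝒢 → 𝒢'` (identity on `𝔾`; `𝒢'_v = B(Π_v/N_v)`,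
`𝒢'_e = 𝒢_e`) with `Ker(Π_v → π₁(𝒢'_v)) = N_v`, `|π₁(𝒢'_v)| = [Π_v : N_v]` at every basepoint, and
all branch subgroups of `𝒢'` trivial. [cite: MochizukiSemiAnbd2006, Ex. 2.8 p.31] -/
theorem exists_quotientApproximator (htriv : 𝒢.HasTrivialEdgeAnabelioids)
    (Fv : ∀ v : 𝒢.graph.Vertex, 𝒢.V v ⥤ FintypeCat.{v₁}) [∀ v, FiberFunctor (Fv v)]
    (N : ∀ v, Subgroup (Aut (Fv v))) (hNo : ∀ v, IsOpen (N v : Set (Aut (Fv v))))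
    (hNn : ∀ v, (N v).Normal) (M : ℕ) (hM : 1 ≤ M) (hdvd : ∀ v, (N v).index ∣ M) :
    ∃ (𝒢' : SemiGraphOfAnabelioids.{v₁, u₁, u}) (φ : Hom 𝒢 𝒢'),
      φ.IsPi1EpiApproximator ∧
      (∀ v, (pi1Map (φ.φV v).pullback (Fv v)).ker = N v) ∧
      (∀ (v : 𝒢.graph.Vertex) (F : 𝒢'.V (φ.base.vertexMap v) ⥤ FintypeCat.{v₁}) [FiberFunctor F],
        Finite (Aut F) ∧ Nat.card (Aut F) = (N v).index) ∧
      ∀ (v : 𝒢.graph.Vertex) (F : 𝒢'.V (φ.base.vertexMap v) ⥤ FintypeCat.{v₁}) [FiberFunctor F]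
        (b : 𝒢'.graph.Branch) (h : 𝒢'.graph.abuts b = some (φ.base.vertexMap v))
        (Fe : 𝒢'.E (𝒢'.graph.edgeOf b) ⥤ FintypeCat.{v₁}) (α : (𝒢'.pull b _ h).pullback ⋙ Fe ≅ F),
        𝒢'.branchSubgroup F b h Fe α = ⊥ := by
  haveI := hNn
  let 𝒢' : SemiGraphOfAnabelioids.{v₁, u₁, u} :=
    { graph := 𝒢.graph
      V := fun v => Fixed (Fv v) (N v)
      E := 𝒢.E
      pull := fun b v h => (𝒢.pull b v h).comp (Hom.toFixed (Fv v) (N v)) }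
  let φ : Hom 𝒢 𝒢' :=
    { base := 𝟙 𝒢.graph
      φV := fun v => Hom.toFixed (Fv v) (N v)
      φE := fun _ _ hf => 𝒢.transportHom hf
      φB := fun _ _ _ => Iso.refl _ }
  have hcard : ∀ (v : 𝒢.graph.Vertex) (F : 𝒢'.V v ⥤ FintypeCat.{v₁}) [FiberFunctor F],
      Finite (Aut F) ∧ Nat.card (Aut F) = (N v).index := fun v F _ =>
    finite_aut_fixed_and_card (Fv v) (N v) (hNo v) F
  refine ⟨𝒢', φ, ⟨⟨?_, ⟨fun b v h F _ => ?_⟩, M, hM, fun v F _ => ?_⟩, fun v => ?_, fun e => ?_⟩,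
    fun v => ker_pi1Map_fixedι (Fv v) (N v) (hNo v), hcard, fun v F _ b h Fe α => ?_⟩
  · show IsIso (𝟙 𝒢.graph)
    infer_instance
  · -- injective type: the edge groups are trivial
    haveI := htriv.subsingleton (𝒢.graph.edgeOf b) F
    exact Function.injective_of_subsingleton _
  · exact ⟨(hcard v F).1, (hcard v F).2 ▸ hdvd v⟩
  · exact isPi1Epi_fixedι (Fv v) (N v) (hNo v)
  · show IsPi1Epi (𝟭 (𝒢.E e))
    exact isPi1Epi_id _
  · -- branch subgroups vanish
    change 𝒢.graph.Branch at b
    change 𝒢.graph.Vertex at v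
    change 𝒢.graph.abuts b = some v at h
    show ((Aut.autMulEquivOfIso α).toMonoidHom.comp
      (pi1Map (𝒢'.pull b v h).pullback Fe)).range = ⊥
    rw [MonoidHom.range_eq_bot_iff]
    ext τ : 1
    rw [MonoidHom.comp_apply, MulEquiv.coe_toMonoidHom, MonoidHom.one_apply,
      MulEquiv.map_eq_one_iff]
    exact pi1Map_eq_one_of_trivial_pi1 _ (fun F' _ => htriv.subsingleton _ F') F Fe α τ

variable {𝒢}

/-- **Trivial edge anabelioids ⇒ quasi-coherent** ([SemiAnbd] Ex. 2.8): split a collection of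
coverings `U_v ⊆ Π_v` of index `≤ M` by the quotient approximator for the normal cores of the `U_v`
(indices divide `M!`). [cite: MochizukiSemiAnbd2006, Ex. 2.8 p.31] -/
theorem isQuasiCoherent_of_hasTrivialEdgeAnabelioids (htriv : 𝒢.HasTrivialEdgeAnabelioids) :
    𝒢.IsQuasiCoherent := by
  refine ⟨⟨fun b v h F _ => ?_⟩, fun M hM 𝒞 => ?_⟩
  · haveI := htriv.subsingleton (𝒢.graph.edgeOf b) F
    exact Function.injective_of_subsingleton _
  · haveI := 𝒞.fiberV
    haveI := 𝒞.fiberE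
    -- the normal cores of the `U_v`
    have hfin : ∀ v, (𝒞.UV v).FiniteIndex := fun v =>
      @Subgroup.finiteIndex_of_finite_quotient _ _ _
        ((𝒞.UV v).quotient_finite_of_isOpen (𝒞.isOpen_UV v))
    have hNo : ∀ v, IsOpen ((𝒞.UV v).normalCore : Set (Aut (𝒞.FV v))) := fun v => by
      haveI := hfin v
      exact Subgroup.isOpen_of_isClosed_of_finiteIndex _
        (Subgroup.normalCore_isClosed _ (Subgroup.isClosed_of_isOpen _ (𝒞.isOpen_UV v)))
    have hdvd : ∀ v, (𝒞.UV v).normalCore.index ∣ Nat.factorial M := fun v => by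
      haveI := hfin v
      exact (index_normalCore_dvd_factorial (𝒞.UV v)).trans
        (Nat.factorial_dvd_factorial (𝒞.index_UV v))
    obtain ⟨𝒢', φ, happ, hker, -, -⟩ := 𝒢.exists_quotientApproximator htriv 𝒞.FV
      (fun v => (𝒞.UV v).normalCore) hNo (fun v => Subgroup.normalCore_normal _)
      (Nat.factorial M) (Nat.succ_le_of_lt (Nat.factorial_pos M)) hdvd
    refine ⟨𝒢', φ, happ.isApproximator, fun v => ?_, fun e => ?_⟩
    · rw [hker]
      exact Subgroup.normalCore_le _
    · haveI := htriv.subsingleton e (𝒞.FE e)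
      intro x _
      rw [Subsingleton.elim x 1]
      exact one_mem _

/-- **Elevated ⇒ `Π_v` infinite** ([SemiAnbd] Ex. 2.8, for any `𝒢`): a `π₁`-epimorphic
approximator maps `Π_v` onto the finite group `π₁(𝒢'_v)`, which contains subgroups of every
size `M`. [cite: MochizukiSemiAnbd2006, Ex. 2.8 p.31] -/
theorem infinite_of_isElevated (v : 𝒢.graph.Vertex) (hv : 𝒢.IsElevated v)
    (F : 𝒢.V v ⥤ FintypeCat.{v₁}) [FiberFunctor F] : Infinite (Aut F) := by
  refine not_finite_iff_infinite.mp fun hfin => ?_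
  obtain ⟨𝒢', φ, hφ, hN⟩ := hv (Nat.card (Aut F) + 1) (Nat.succ_pos _)
  haveI : FiberFunctor ((φ.φV v).pullback ⋙ F) := fiberFunctor_comp_of_exact _ _
  obtain ⟨N, hNfin, hMN, -⟩ := hN ((φ.φV v).pullback ⋙ F)
  have hsurj := hφ.isPi1Epi_V v F
  haveI : Finite (Aut ((φ.φV v).pullback ⋙ F)) := Finite.of_surjective _ hsurj
  have h1 : Nat.card N ≤ Nat.card (Aut ((φ.φV v).pullback ⋙ F)) :=
    Nat.card_le_card_of_injective _ N.subtype_injective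
  have h2 : Nat.card (Aut ((φ.φV v).pullback ⋙ F)) ≤ Nat.card (Aut F) :=
    Nat.card_le_card_of_surjective _ hsurj
  omega

/-- **Trivial edge anabelioids and `Π_v` infinite ⇒ `v` elevated** ([SemiAnbd] Ex. 2.8): the
quotient approximator for an open normal `N_v ⊆ Π_v` of index `≥ M` (and `N_w = Π_w` at the other
vertices), with `N := π₁(𝒢'_v)` — its branch subgroups are trivial.
[cite: MochizukiSemiAnbd2006, Ex. 2.8 p.31] -/
theorem isElevated_of_infinite (htriv : 𝒢.HasTrivialEdgeAnabelioids) (v : 𝒢.graph.Vertex)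
    (hinf : ∀ (F : 𝒢.V v ⥤ FintypeCat.{v₁}) [FiberFunctor F], Infinite (Aut F)) :
    𝒢.IsElevated v := by
  classical
  intro M _
  let Fv : ∀ w : 𝒢.graph.Vertex, 𝒢.V w ⥤ FintypeCat.{v₁} := fun w =>
    GaloisCategory.getFiberFunctor (𝒢.V w)
  haveI := hinf (Fv v)
  obtain ⟨N₀, hN₀o, hN₀n, hMN₀⟩ := exists_openNormal_le_index (G := Aut (Fv v)) M
  let N : ∀ w, Subgroup (Aut (Fv w)) := Function.update (fun w => ⊤) v N₀
  have hNv : N v = N₀ := by simp only [N, Function.update_self]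
  have hNw : ∀ w, w ≠ v → N w = ⊤ := fun w hw => by simp only [N, Function.update_of_ne hw]
  have hNo : ∀ w, IsOpen (N w : Set (Aut (Fv w))) := fun w => by
    by_cases hw : w = v
    · subst hw; rw [hNv]; exact hN₀o
    · rw [hNw w hw]; exact isOpen_univ
  have hNn : ∀ w, (N w).Normal := fun w => by
    by_cases hw : w = v
    · subst hw; rw [hNv]; exact hN₀n
    · rw [hNw w hw]; infer_instance
  haveI : Finite (Aut (Fv v) ⧸ N₀) := N₀.quotient_finite_of_isOpen hN₀o
  haveI : N₀.FiniteIndex := Subgroup.finiteIndex_of_finite_quotient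
  have hdvd : ∀ w, (N w).index ∣ N₀.index := fun w => by
    by_cases hw : w = v
    · subst hw; rw [hNv]
    · rw [hNw w hw, Subgroup.index_top]; exact one_dvd _
  obtain ⟨𝒢', φ, happ, -, hcard, hbr⟩ := 𝒢.exists_quotientApproximator htriv Fv N hNo hNn
    N₀.index (Nat.one_le_iff_ne_zero.mpr Subgroup.FiniteIndex.index_ne_zero) hdvd
  refine ⟨𝒢', φ, happ, fun F _ => ⟨⊤, ?_, ?_, fun b h Fe _ α g => ?_⟩⟩
  · haveI := (hcard v F).1
    exact Finite.of_injective _ (⊤ : Subgroup (Aut F)).subtype_injective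
  · rw [Subgroup.card_top, (hcard v F).2, hNv]
    exact hMN₀
  · rw [hbr v F b h Fe α, Subgroup.smul_bot, inf_bot_eq]

/-- NAMED FACT `example_2_8_quasiCoherent_elevated` ([SemiAnbd] Ex. 2.8, first two assertions),
PROVED: a semi-graph of anabelioids with trivial edge anabelioids is quasi-coherent, and a vertex
`v` is elevated iff `Π_v` is infinite (at every basepoint). [cite: MochizukiSemiAnbd2006, Ex. 2.8 p.31] -/
theorem example_2_8_quasiCoherent_elevated_holds : example_2_8_quasiCoherent_elevated.{v₁, u₁, u} :=
  fun _ htriv => ⟨isQuasiCoherent_of_hasTrivialEdgeAnabelioids htriv, fun v =>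
    ⟨fun hv F _ => infinite_of_isElevated v hv F, isElevated_of_infinite htriv v⟩⟩

end SemiGraphOfAnabelioids

end Literature.AnabelianGeometry.SemiGraphs
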